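import Literature.MathematicalPhysics.QuantumFieldTheory.Balaban1983to89.B9Eq3124GaugeModes

/-!
# `Balaban1983to89.B9Eq3119InvariantExtension` — T. Bałaban, *Propagators for lattice gauge theories in a background field*, Commun.
# Math. Phys. **99** (1985) 389–434 [Balaban1985BackgroundPropagators] (3.113)–(3.115) p. 418, (3.117)–(3.119) p. 419, (3.122) p. 420,
# (3.128), (3.130) p. 421, with (3.24)–(3.25) p. 394: THE GAUGE-INVARIANT EXTENSION `Δ_π` OF THE QUADRATIC FORM `⟨A, ΔA⟩` KILLS THE
# `Q′`-INVISIBLE GAUGE MODES — the gauge-mode letter (g1) of `B9Eq3124GaugeModes` is a PRINTED PROPERTY of the operator print inverts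

statement-level skeleton of published theorems with citation tags; proofs where landed; nothing here is a claim
about the Yang–Mills mass gap

PDF held: `paper:balaban1985-cmp99-background-propagators` (journal page = PDF page + 388); pp. 394–395, 418–421, 425–426 read by this
seat (2026-08-21) in the held text layer; [Balaban1985Variational] (80), (87) pp. 290–291, pp. 293–294 likewise
(`paper:balaban1985-cmp102-variational-background`, journal page = PDF page + 276).

THE PRINT (verbatim, [B9] unless marked).
* p. 418, (3.114)–(3.115) and L25–27: *«(QD_{U}λ)(c) = R_c(Q′λ)(c₊) − (Q′λ)(c₋) = (D_{Ū}Q′λ)(c). (3.114) Iterating this identity we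
  obtain finally Q_jD λ = … = D_jQ′_jλ, (3.115) … These equalities are simple generalizations of the identity Q_k d = d₁Q′_k used in
  [3,4]. In particular they imply that the average QA are invariant with respect to gauge transformations λ satisfying Q′λ = 0,
  i.e. λ ∈ N(Q′).»* — this is the letter (g2) `∀ λ, Q′λ = 0 → Q(Dλ) = 0` of `B9Eq3124GaugeModes`, IN PRINT for Bałaban's `Q(U)`.
* p. 419, (3.117): *«⟨A − Dλ, Δ(A − Dλ)⟩ = ⟨A, ΔA⟩ − ⟨…⟩ (3.117) The last equality can be interpreted as almost invariance of the
  quadratic form, the error terms are small because the function J = D*η⁻² Im ∂U is small, if U satisfies the condition (3.36).»* —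
  for the BARE Hessian `Δ` of (3.12) print claims ALMOST invariance only.
* p. 419, (3.118)–(3.119): *«It is convenient to have a gauge invariant quadratic form … We define a new quadratic form extending
  ⟨A, ΔA⟩ in a gauge invariant way to all configurations A. … (3.118) where we have used the identity RD*(A − Dλ) = RD*A − RΔλ =
  RD*A − Δλ, which holds by the definition of R and the fact that λ ∈ N(Q′). Calculating the integral above we get
  ⟨A, Δ_π A⟩ = ⟨A − DG′RD*A, Δ(A − DG′RD*A)⟩. (3.119) The quadratic form is invariant with respect to gauge transformations
  determined by λ ∈ N(Q′). This follows from the integral formula (3.118), but also from the above explicit representation. In fact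
  the expression A − DG′RD*A has this invariance property.»*; p. 394 (3.24)–(3.25): *«Δ′_a = Δ^η_U + Q′*aQ′ … G′ = G′(U) = (Δ′_a)⁻¹»*.
* p. 420, (3.122): *«G̃⁻¹ defined as G̃⁻¹ = Δ_π + DRD* + Q*aQ»*; p. 420 L1–2: *«In the second equality we have used (3.115) and the
  condition Q′λ = 0. They imply that QA is gauge invariant»*; (3.124)–(3.125) ibid.; p. 421: *«Let us denote for a moment the operator
  we have investigated in previous sections by G₀, i.e. G₀ = (Δ + DRD* + Q*aQ)⁻¹. From (3.120) we get G = G₀(I − Δ′_πG₀)⁻¹ (3.130)»*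
  and (3.128) (the operator `G₁` of `H₁B = G₁Q*(QG₁Q*)⁻¹B` (3.129), whose form is again written through `A − DG′RD*A`).
* [B11] p. 290 (80) *«V(A′) = −⟨HD₃(A′), J⟩ − ⟨A′, Δ_π HD(A′)⟩ + …»*, p. 291 (87) *«⟨A′, (Δ_π + DRD*)HD(A′)⟩»*; p. 294: *«We denote
  by G₁ an inverse operator to the operator Δ₁ + DRD* + aQ*Q … In [5] we have proved that the operator G₁𝔓* is equal to the
  operator 𝔊 defined by (3.148) and satisfying the equalities Q𝔊 = 0, RD*𝔊 = 0.»*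

WHY THIS FILE (cell context).  `B9Eq3124GaugeModes` (this lineage, p298618) derives the (3.124)-identities `QG₁DR = 0`,
`RD*G₁DR = R`, `RD*G₁Q* = 0` at the constructed `R` of (3.21) from two facts about the DATA: (g1) `Q′λ = 0 → Δ₁(Dλ) = 0` and
(g2) `Q′λ = 0 → Q(Dλ) = 0`.  The row's standing caveat (X-reads C-ne9leaf01g67-1 INFO-2, C-ne9leaf04g61/g63 Z1/Z2) was that (g1)
holds for the Wilson Hessian (3.12) only at the flat background.  Print resolves this: (g2) IS (3.115), and the operator whose
inverse enters (3.122)–(3.126) / (3.128)–(3.129) / [B11] (103), (110) is NOT the bare `Δ` (slot of `G₀`, p. 421) but its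
GAUGE-INVARIANT EXTENSION `Δ_π` of (3.118)–(3.119), for which (g1) holds BY CONSTRUCTION.  This file types that construction at the
abstract `RCLike` Hilbert level of `B11Eq103H1Complex` and at its lattice letters, and composes it with `B9Eq3124GaugeModes`.

WHAT IS PROVED (sorry-free; theorems only; no definition, no `Prop` placeholder, no inequality of the papers).
* §1 For a SYMMETRIC `Δ`: the quadratic form is invariant under `A ↦ A − v` for all `A` IFF `Δv = 0`
  (`apply_eq_zero_of_formInvariant`, `formInvariant_of_apply_eq_zero`) — print's sentence p. 419 ⟺ the letter (g1).
* §2 The extension (3.119) as an OPERATOR `π† ∘ Δ ∘ π` for any linear `π`: `inner_invariantExtension` ((3.119) verbatim: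
  `⟨A, Δ_π B⟩ = ⟨πA, Δ(πB)⟩`), `invariantExtension_isSymmetric`, **`invariantExtension_apply_eq_zero`** (`πv = 0 → Δ_π v = 0`, no
  hypothesis on `Δ`), `invariantExtension_formInvariant` (print's «invariant with respect to gauge transformations»).
* §3 Print's `π = 1 − DG′RD*` kills the gauge modes `Dλ`, `λ ∈ N`: from (g3) `R(D*Dλ) = D*Dλ` ((3.21)) and (g5) `G′(D*Dλ) = λ`
  ((3.24)–(3.25): `Δ′_a λ = Δ_U λ` on `N(Q′)`): `R_Dstar_sub_gaugeMode` (print's «RD*(A − Dλ) = RD*A − Δλ»),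
  **`printProjection_gaugeMode`**, `printProjection_sub_gaugeMode` («A − DG′RD*A has this invariance property»).
* §4 At the lattice letters of `B11Eq103H1Complex` (`Rr := RLatticeK c R S Q′`, `Δ_U = covLaplaceSiteK c R S`, (g3) =
  `RLatticeK_apply_of_ker`): `printProjectionLattice_gaugeMode` ⇐ (g5) alone; `printGreen_gaugeMode` ((g5) DISCHARGED for
  `G′ := greenK T′` of any `T′` agreeing with `Δ_U` on `N(Q′)`, as print's `Δ′_a = Δ_U + Q′*aQ′` does), `printProjectionLattice_gaugeMode_greenK`; and, composing with `B9Eq3124GaugeModes`, for a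
  Hessian slot of the form `Δ₁ := π† ∘ Δ ∘ π` with `π` killing the `N(Q′)` gauge modes: **`h124_of_invariantExtension`**,
  **`hRDR_of_invariantExtension`** ⇐ (g2) ALONE, **`h124'_of_invariantExtension`** ⇐ (g2) + `conj c = c`, mutually adjoint
  transporters, `Δ` symmetric; **`h124_of_printExtension`** — the same with print's own `π = 1 − D_U G′ R D*_U` ⇐ (g2) + (g5).

MODEL / DECLARED READINGS.  (M1) as in `B11Eq103H1Complex` / `B9Eq3124GaugeModes`.  (M2) `Δ_π` is typed as the OPERATOR
`π†Δπ` representing the form (3.119) (print writes the form; for symmetric `Δ` the two agree, `inner_invariantExtension`); the extra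
term `−2⟨C₁⁽²⁾(A − DG′RD*A), J⟩` of (3.128) is again a function of `πA` and falls under §2 with `Δ` replaced by the corresponding
symmetric operator — `C⁽²⁾`, `J` are not objects of the tree and are not typed.  (M3) DISPLAYED, never asserted: `hpos` ([B9] Thm 3.11
for `G`, p. 420 L33–p. 421 L1), `hQ`, (g2) at the concrete `Q(U)` ((3.115) — a lattice identity claimed here by nobody), (g5) at the
concrete `G′(U)`.  (M4) NOT HERE: Thm 3.11/3.13 for `G`, `G₁`, `𝔊`; the smallness of `Δ′_π` (3.120), (3.130)–(3.133); any estimate.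
HONEST SCOPE.  [folklore] finite-dimensional Hilbert-space algebra around printed operator formulas; no estimate of the papers; NOT
summit progress (cell pub-balaban: NE9 NOT PRINTED / NOT PROVED; spine PROVED 0/9).  Staged by the pub-balaban NE9 leaf lineage
`b2b-balaban-t4-ne9-formalise-leaf-01` (gen 69); a NEW file importing `B9Eq3124GaugeModes` only; nothing of the owner's or of
lit-balaban's is modified.  Net new unproved facts: 0.
-/

noncomputable section

open scoped InnerProductSpace ComplexConjugate BigOperators

namespace Literature.MathematicalPhysics.QuantumFieldTheory.Balaban1983to89.B9Eq3119InvariantExtension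

open B11Eq103H1Complex B9Eq3124GaugeModes

/-! ## §1 Invariance of a symmetric quadratic form under `A ↦ A − v` ⟺ `Δv = 0` -/

section Form

variable {𝕜 : Type*} [RCLike 𝕜] {E : Type*} [NormedAddCommGroup E] [InnerProductSpace 𝕜 E] {Δ : E →ₗ[𝕜] E}

/-- **Print's sentence p. 419 «the quadratic form is invariant with respect to gauge transformations determined by λ» FORCES the
letter (g1)**: for a SYMMETRIC `Δ`, if `⟨A − v, Δ(A − v)⟩ = ⟨A, ΔA⟩` for all `A`, then `Δv = 0` (take `A = v`, then `A = Δv + v`).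
[cite: Balaban1985BackgroundPropagators, (3.119) p.419] -/
theorem apply_eq_zero_of_formInvariant (hΔ : Δ.IsSymmetric) (v : E) (hinv : ∀ A : E, ⟪A - v, Δ (A - v)⟫_𝕜 = ⟪A, Δ A⟫_𝕜) :
    Δ v = 0 := by
  have h0 : ⟪v, Δ v⟫_𝕜 = 0 := by
    have h := hinv v
    rw [sub_self, map_zero, inner_zero_left] at h
    exact h.symm
  have h1 : ∀ B : E, ⟪B, Δ v⟫_𝕜 + ⟪v, Δ B⟫_𝕜 = 0 := fun B => by
    have h := hinv (B + v)
    rw [add_sub_cancel_right, map_add, inner_add_left, inner_add_right, inner_add_right, h0, add_zero] at h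
    linear_combination -h
  have h2 : ⟪Δ v, Δ v⟫_𝕜 + ⟪Δ v, Δ v⟫_𝕜 = 0 := by
    have h := h1 (Δ v)
    rwa [← hΔ v (Δ v)] at h
  exact inner_self_eq_zero.1 (add_self_eq_zero.1 h2)

/-- Conversely `Δv = 0` (with `Δ` symmetric) makes the form invariant under `A ↦ A − v`: (g1) ⟹ print's sentence.
[cite: Balaban1985BackgroundPropagators, (3.119) p.419] -/
theorem formInvariant_of_apply_eq_zero (hΔ : Δ.IsSymmetric) {v : E} (hv : Δ v = 0) (A : E) :
    ⟪A - v, Δ (A - v)⟫_𝕜 = ⟪A, Δ A⟫_𝕜 := by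
  rw [map_sub, hv, sub_zero, inner_sub_left, ← hΔ v A, hv, inner_zero_left, sub_zero]

end Form

/-! ## §2 The gauge-invariant extension (3.119) as the operator `π† Δ π` -/

section Extension

variable {𝕜 : Type*} [RCLike 𝕜] {E : Type*} [NormedAddCommGroup E] [InnerProductSpace 𝕜 E] [FiniteDimensional 𝕜 E]

/-- **(3.119) `⟨A, Δ_π B⟩ = ⟨πA, Δ(πB)⟩`** for `Δ_π := π† ∘ Δ ∘ π` — print's «⟨A, Δ_πA⟩ = ⟨A − DG′RD*A, Δ(A − DG′RD*A)⟩» with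
`π = 1 − DG′RD*`, polarized. [cite: Balaban1985BackgroundPropagators, (3.119) p.419] -/
theorem inner_invariantExtension (π Δ : E →ₗ[𝕜] E) (A B : E) :
    ⟪A, (LinearMap.adjoint π ∘ₗ Δ ∘ₗ π) B⟫_𝕜 = ⟪π A, Δ (π B)⟫_𝕜 := by
  rw [LinearMap.comp_apply, LinearMap.comp_apply, LinearMap.adjoint_inner_right]

/-- `Δ_π = π†Δπ` is symmetric when `Δ` is. [cite: Balaban1985BackgroundPropagators, (3.119) p.419] -/
theorem invariantExtension_isSymmetric (π : E →ₗ[𝕜] E) {Δ : E →ₗ[𝕜] E} (hΔ : Δ.IsSymmetric) :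
    (LinearMap.adjoint π ∘ₗ Δ ∘ₗ π).IsSymmetric := by
  intro A B
  simp only [LinearMap.comp_apply]
  rw [LinearMap.adjoint_inner_left, LinearMap.adjoint_inner_right]
  exact hΔ _ _

/-- **`Δ_π` KILLS WHATEVER `π` KILLS — the letter (g1) for the extended operator, with NO hypothesis on `Δ`.**
[cite: Balaban1985BackgroundPropagators, (3.119) p.419] -/
theorem invariantExtension_apply_eq_zero (π Δ : E →ₗ[𝕜] E) {v : E} (hπ : π v = 0) :
    (LinearMap.adjoint π ∘ₗ Δ ∘ₗ π) v = 0 := by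
  simp only [LinearMap.comp_apply, hπ, map_zero]

/-- **Print's «The quadratic form is invariant with respect to gauge transformations determined by λ ∈ N(Q′)»** for `Δ_π`, from
`π(Dλ) = 0` alone (no symmetry of `Δ` needed). [cite: Balaban1985BackgroundPropagators, (3.119) p.419] -/
theorem invariantExtension_formInvariant (π Δ : E →ₗ[𝕜] E) {v : E} (hπ : π v = 0) (A : E) :
    ⟪A - v, (LinearMap.adjoint π ∘ₗ Δ ∘ₗ π) (A - v)⟫_𝕜 = ⟪A, (LinearMap.adjoint π ∘ₗ Δ ∘ₗ π) A⟫_𝕜 := by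
  rw [inner_invariantExtension, inner_invariantExtension, map_sub, hπ, sub_zero]

end Extension

/-! ## §3 Print's `π = 1 − DG′RD*` kills the gauge modes `Dλ`, `λ ∈ N(Q′)` -/

section PrintProjection

variable {𝕜 : Type*} [RCLike 𝕜] {E : Type*} [AddCommGroup E] [Module 𝕜 E] {S : Type*} [AddCommGroup S] [Module 𝕜 S]
  {D : S →ₗ[𝕜] E} {R Gp : S →ₗ[𝕜] S} {Dstar : E →ₗ[𝕜] S}

/-- Print's identity «`RD*(A − Dλ) = RD*A − RΔλ = RD*A − Δλ`, which holds by the definition of `R` and the fact that `λ ∈ N(Q′)`»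
(`Δ = D*D`; (g3) `R(D*Dλ) = D*Dλ` is (3.21)). [cite: Balaban1985BackgroundPropagators, (3.118) p.419] -/
theorem R_Dstar_sub_gaugeMode (N : Set S) (g3 : ∀ l ∈ N, R (Dstar (D l)) = Dstar (D l)) (A : E) {l : S} (hl : l ∈ N) :
    R (Dstar (A - D l)) = R (Dstar A) - Dstar (D l) := by
  rw [map_sub, map_sub, g3 l hl]

/-- **`(1 − DG′RD*)(Dλ) = 0` for `λ ∈ N(Q′)`** from (g3) `R(D*Dλ) = D*Dλ` ((3.21)) and (g5) `G′(D*Dλ) = λ` ((3.24)–(3.25):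
`G′ = (Δ_U + Q′*aQ′)⁻¹` and `Q′λ = 0`). [cite: Balaban1985BackgroundPropagators, (3.119) p.419] -/
theorem printProjection_gaugeMode (N : Set S) (g3 : ∀ l ∈ N, R (Dstar (D l)) = Dstar (D l))
    (g5 : ∀ l ∈ N, Gp (Dstar (D l)) = l) {l : S} (hl : l ∈ N) :
    ((LinearMap.id : E →ₗ[𝕜] E) - D ∘ₗ Gp ∘ₗ R ∘ₗ Dstar) (D l) = 0 := by
  simp only [LinearMap.sub_apply, LinearMap.id_apply, LinearMap.comp_apply, g3 l hl, g5 l hl, sub_self]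

/-- Print's «the expression `A − DG′RD*A` has this invariance property»: `π(A − Dλ) = πA` for `λ ∈ N(Q′)`.
[cite: Balaban1985BackgroundPropagators, (3.119) p.419] -/
theorem printProjection_sub_gaugeMode (N : Set S) (g3 : ∀ l ∈ N, R (Dstar (D l)) = Dstar (D l))
    (g5 : ∀ l ∈ N, Gp (Dstar (D l)) = l) (A : E) {l : S} (hl : l ∈ N) :
    ((LinearMap.id : E →ₗ[𝕜] E) - D ∘ₗ Gp ∘ₗ R ∘ₗ Dstar) (A - D l) = ((LinearMap.id : E →ₗ[𝕜] E) - D ∘ₗ Gp ∘ₗ R ∘ₗ Dstar) A := by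
  rw [map_sub, printProjection_gaugeMode N g3 g5 hl, sub_zero]

end PrintProjection

/-! ## §4 At the lattice letters of `B11Eq103H1Complex`, composed with `B9Eq3124GaugeModes` -/

section Lattice

open B9SectCLatticeCarrier (Bond)
open B4Sect5Torus (TSite)

variable {𝕜 : Type*} [RCLike 𝕜] {d : ℕ} {Pd : Fin d → ℕ} {W : Type*} [NormedAddCommGroup W] [InnerProductSpace 𝕜 W]
  [FiniteDimensional 𝕜 W] {c₀ : ℝ} [Fact (0 < c₀)] {F : Type*} [NormedAddCommGroup F] [InnerProductSpace 𝕜 F] [FiniteDimensional 𝕜 F]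
  {F' : Type*} [AddCommGroup F'] [Module 𝕜 F']
  {c : 𝕜} {R S : Bond d Pd → W →ₗ[𝕜] W} {Q : BondL2K 𝕜 d Pd c₀ W →ₗ[𝕜] F} {a : ℝ} {Q' : SiteL2K 𝕜 d Pd c₀ W →ₗ[𝕜] F'}

/-- **Print's `π_U = 1 − D_U G′ R D*_U` kills the `N(Q′)` gauge modes on the lattice**, from (g5) `Q′λ = 0 → G′(Δ_U λ) = λ` alone
((g3) is `B11Eq103H1Complex.RLatticeK_apply_of_ker`). [cite: Balaban1985BackgroundPropagators, (3.119) p.419] -/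
theorem printProjectionLattice_gaugeMode (Gp : SiteL2K 𝕜 d Pd c₀ W →ₗ[𝕜] SiteL2K 𝕜 d Pd c₀ W)
    (g5 : ∀ l : SiteL2K 𝕜 d Pd c₀ W, Q' l = 0 → Gp (covLaplaceSiteK c R S l) = l) {l : SiteL2K 𝕜 d Pd c₀ W} (hl : Q' l = 0) :
    ((LinearMap.id : BondL2K 𝕜 d Pd c₀ W →ₗ[𝕜] BondL2K 𝕜 d Pd c₀ W) - covDerivL2K 𝕜 c₀ c R ∘ₗ Gp ∘ₗ RLatticeK c R S Q' ∘ₗ covDivL2K 𝕜 c₀ c S) (covDerivL2K 𝕜 c₀ c R l) = 0 :=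
  printProjection_gaugeMode (D := covDerivL2K 𝕜 c₀ c R) (R := RLatticeK c R S Q') (Gp := Gp) (Dstar := covDivL2K 𝕜 c₀ c S)
    {l | Q' l = 0} (fun l (hl : Q' l = 0) => RLatticeK_apply_of_ker c R S Q' hl) g5 hl

/-- **(g5) DISCHARGED for print's `G′ = (Δ′_a)⁻¹`** ((3.24)–(3.25)): for ANY operator `T′` on the gauge parameters that AGREES
WITH `Δ_U` ON `N(Q′)` (as `Δ′_a = Δ_U + Q′*aQ′` does) and has positive definite real part, its inverse `B11Eq103H1Complex.greenK T′`
returns `λ` on `Δ_U λ`, `λ ∈ N(Q′)`. [cite: Balaban1985BackgroundPropagators, (3.24)–(3.25) p.394] -/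
theorem printGreen_gaugeMode (T' : SiteL2K 𝕜 d Pd c₀ W →ₗ[𝕜] SiteL2K 𝕜 d Pd c₀ W)
    (hpos' : ∀ x : SiteL2K 𝕜 d Pd c₀ W, x ≠ 0 → 0 < RCLike.re ⟪x, T' x⟫_𝕜)
    (hT' : ∀ l : SiteL2K 𝕜 d Pd c₀ W, Q' l = 0 → T' l = covLaplaceSiteK c R S l) {l : SiteL2K 𝕜 d Pd c₀ W} (hl : Q' l = 0) :
    greenK T' hpos' (covLaplaceSiteK c R S l) = l := by
  rw [← hT' l hl, greenK_apply]

/-- Hence print's `π_U = 1 − D_U G′ R D*_U` WITH `G′ := (T′)⁻¹` CONSTRUCTED kills the `N(Q′)` gauge modes — no letter left but the two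
agreements `T′ = Δ_U` on `N(Q′)` and positivity. [cite: Balaban1985BackgroundPropagators, (3.119) p.419, (3.24)–(3.25) p.394] -/
theorem printProjectionLattice_gaugeMode_greenK (T' : SiteL2K 𝕜 d Pd c₀ W →ₗ[𝕜] SiteL2K 𝕜 d Pd c₀ W)
    (hpos' : ∀ x : SiteL2K 𝕜 d Pd c₀ W, x ≠ 0 → 0 < RCLike.re ⟪x, T' x⟫_𝕜)
    (hT' : ∀ l : SiteL2K 𝕜 d Pd c₀ W, Q' l = 0 → T' l = covLaplaceSiteK c R S l) {l : SiteL2K 𝕜 d Pd c₀ W} (hl : Q' l = 0) :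
    ((LinearMap.id : BondL2K 𝕜 d Pd c₀ W →ₗ[𝕜] BondL2K 𝕜 d Pd c₀ W) -
      covDerivL2K 𝕜 c₀ c R ∘ₗ greenK T' hpos' ∘ₗ RLatticeK c R S Q' ∘ₗ covDivL2K 𝕜 c₀ c S) (covDerivL2K 𝕜 c₀ c R l) = 0 :=
  printProjectionLattice_gaugeMode (greenK T' hpos') (fun _ hl => printGreen_gaugeMode T' hpos' hT' hl) hl

variable (π Δ : BondL2K 𝕜 d Pd c₀ W →ₗ[𝕜] BondL2K 𝕜 d Pd c₀ W)
  (hpos : ∀ x : BondL2K 𝕜 d Pd c₀ W, x ≠ 0 →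
    0 < RCLike.re ⟪x, laplaceALatticeK c R S (LinearMap.adjoint π ∘ₗ Δ ∘ₗ π) (RLatticeK c R S Q') Q a x⟫_𝕜)

/-- **(3.124) `QG₁DR = 0` at the constructed `R` for a Hessian slot of the (3.119) form `Δ₁ := π†Δπ`** with `π` killing the
`N(Q′)` gauge modes: the letter (g1) of `B9Eq3124GaugeModes.h124_RLatticeK` is DISCHARGED, only (g2) ((3.115)) remains.
[cite: Balaban1985BackgroundPropagators, (3.124) p.420] -/
theorem h124_of_invariantExtension (hπ : ∀ l : SiteL2K 𝕜 d Pd c₀ W, Q' l = 0 → π (covDerivL2K 𝕜 c₀ c R l) = 0)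
    (g2 : ∀ l : SiteL2K 𝕜 d Pd c₀ W, Q' l = 0 → Q (covDerivL2K 𝕜 c₀ c R l) = 0) (s : SiteL2K 𝕜 d Pd c₀ W) :
    Q (G1LatticeK hpos (covDerivL2K 𝕜 c₀ c R (RLatticeK c R S Q' s))) = 0 :=
  h124_RLatticeK hpos (fun l hl => invariantExtension_apply_eq_zero π Δ (hπ l hl)) g2 s

/-- **p. 425 `RD*G₁DR = R`** for `Δ₁ := π†Δπ`, from (g2) alone. [cite: Balaban1985BackgroundPropagators, p.425] -/
theorem hRDR_of_invariantExtension (hπ : ∀ l : SiteL2K 𝕜 d Pd c₀ W, Q' l = 0 → π (covDerivL2K 𝕜 c₀ c R l) = 0)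
    (g2 : ∀ l : SiteL2K 𝕜 d Pd c₀ W, Q' l = 0 → Q (covDerivL2K 𝕜 c₀ c R l) = 0) (s : SiteL2K 𝕜 d Pd c₀ W) :
    RLatticeK c R S Q' (covDivL2K 𝕜 c₀ c S (G1LatticeK hpos (covDerivL2K 𝕜 c₀ c R (RLatticeK c R S Q' s)))) =
      RLatticeK c R S Q' s :=
  hRDR_RLatticeK hpos (fun l hl => invariantExtension_apply_eq_zero π Δ (hπ l hl)) g2 s

/-- **(3.124) `RD*G₁Q* = 0`** for `Δ₁ := π†Δπ` with `Δ` symmetric, `conj c = c` and mutually adjoint transporters, from (g2).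
[cite: Balaban1985BackgroundPropagators, (3.124) p.420] -/
theorem h124'_of_invariantExtension (hc : conj c = c) (hRS : ∀ (b : Bond d Pd) (v u : W), ⟪R b v, u⟫_𝕜 = ⟪v, S b u⟫_𝕜)
    (hΔ : Δ.IsSymmetric) (hπ : ∀ l : SiteL2K 𝕜 d Pd c₀ W, Q' l = 0 → π (covDerivL2K 𝕜 c₀ c R l) = 0)
    (g2 : ∀ l : SiteL2K 𝕜 d Pd c₀ W, Q' l = 0 → Q (covDerivL2K 𝕜 c₀ c R l) = 0) (y : F) :
    RLatticeK c R S Q' (covDivL2K 𝕜 c₀ c S (G1LatticeK hpos (LinearMap.adjoint Q y))) = 0 :=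
  h124'_RLatticeK hpos hc hRS (invariantExtension_isSymmetric π hΔ)
    (fun l hl => invariantExtension_apply_eq_zero π Δ (hπ l hl)) g2 y

omit π hpos in
/-- **(3.124) `QG₁DR = 0` WITH PRINT'S OWN EXTENSION `π_U = 1 − D_U G′ R D*_U`**: from (g2) ((3.115)) and (g5) ((3.24)–(3.25)) —
no letter on the Hessian `Δ`. [cite: Balaban1985BackgroundPropagators, (3.119) p.419, (3.124) p.420] -/
theorem h124_of_printExtension (Gp : SiteL2K 𝕜 d Pd c₀ W →ₗ[𝕜] SiteL2K 𝕜 d Pd c₀ W)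
    (hpos : ∀ x : BondL2K 𝕜 d Pd c₀ W, x ≠ 0 → 0 < RCLike.re ⟪x, laplaceALatticeK c R S
      (LinearMap.adjoint ((LinearMap.id : BondL2K 𝕜 d Pd c₀ W →ₗ[𝕜] BondL2K 𝕜 d Pd c₀ W) - covDerivL2K 𝕜 c₀ c R ∘ₗ Gp ∘ₗ RLatticeK c R S Q' ∘ₗ covDivL2K 𝕜 c₀ c S) ∘ₗ Δ ∘ₗ
        ((LinearMap.id : BondL2K 𝕜 d Pd c₀ W →ₗ[𝕜] BondL2K 𝕜 d Pd c₀ W) - covDerivL2K 𝕜 c₀ c R ∘ₗ Gp ∘ₗ RLatticeK c R S Q' ∘ₗ covDivL2K 𝕜 c₀ c S)) (RLatticeK c R S Q') Q a x⟫_𝕜)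
    (g5 : ∀ l : SiteL2K 𝕜 d Pd c₀ W, Q' l = 0 → Gp (covLaplaceSiteK c R S l) = l)
    (g2 : ∀ l : SiteL2K 𝕜 d Pd c₀ W, Q' l = 0 → Q (covDerivL2K 𝕜 c₀ c R l) = 0) (s : SiteL2K 𝕜 d Pd c₀ W) :
    Q (G1LatticeK hpos (covDerivL2K 𝕜 c₀ c R (RLatticeK c R S Q' s))) = 0 :=
  h124_of_invariantExtension _ Δ hpos (fun _ hl => printProjectionLattice_gaugeMode Gp g5 hl) g2 s

end Lattice

end Literature.MathematicalPhysics.QuantumFieldTheory.Balaban1983to89.B9Eq3119InvariantExtension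

end
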